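import Summits.Ventures.YMGap.RobustBall.StringTensionOnBallW
import HarnessLib

/-!
# Robust ball (Y2), area-law side — the area law of the limit states for EVERY rectangular loop (all planes, all base points)

HONEST FRAMING: venture file of the cell `pub-ymgap` (QuantumFields programme), track ROBUST-BALL, seat rb-p2 (g2).  Strong-coupling LATTICE
statements; nothing about the continuum, a spectral mass gap, or Clay.

WHAT.  `StringTensionOnBall(W)` lands the ball area law in the tree's currency `HasAreaLawWith μ χ C c`, which speaks of the rectangles in the `(0,1)`
plane based at the origin (the currency the tree's string tension is built on).  The torus statement `AreaLawOnBall` controls EVERY rectangular loop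
(every base point `x`, every plane `i ≠ j`), and so does its infinite-volume form: this file records, with the SAME constants, the bound
`|⟨W_{x;i,j}(R×T)⟩_μ| ≤ C^{2(R+T)} e^{−cRT}` (`loopExpectation μ χ_N (rectWalk x i j R T)`) for every infinite-volume limit state `μ` of every
eventually-member family, every `x : Site d`, every `i ≠ j`, every `R, T ≥ 1` (`areaLaw_allLoops_onBall`, tier-2 twin `areaLaw_allLoops_onBallW`), via the
general-position passage lemmas `tendsto_expectation_wilsonLoop_at` / `abs_loopExpectation_le_of_eventually_perturbed`.  No `d ≥ 2` hypothesis is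
needed (it is carried by `i ≠ j`).  Nothing else is claimed.
-/

noncomputable section

open MeasureTheory Filter Topology
open Literature.Probability.LatticeModels (Site Torus.proj)
open Literature.MathematicalPhysics.QuantumLattice
open Literature.MathematicalPhysics.QuantumFieldTheory hiding ZdEdge Site

namespace Summit.Ventures.YMGap.RobustBall

variable {d N : ℕ}

/-- The expectation of the rectangular loop based at `x` in the plane `(i, j)` under a limit state is the limit of the member's torus Wilson-loop
expectations at the projected base point along the defining subsequence. [folklore] -/
theorem tendsto_expectation_wilsonLoop_at {β : ℝ} {𝓦 : PerturbationFamily d N} {μ : Measure (LGConfig d (SUN N))} {Ls : ℕ → ℕ}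
    (hμ : IsPerturbedLimitAlong β 𝓦 Ls μ) (x : Site d) (i j : Fin d) (R T : ℕ) :
    Tendsto (fun k : ℕ => (𝓦 (Ls k)).expectation (fundamentalRep (Fin N)) β
        (wilsonLoop (fundamentalRep (Fin N)) (Torus.proj (Ls k + 1) x) i j R T))
      atTop (𝓝 (loopExpectation μ (fun g => normalisedCharacter N (fundamentalRep (Fin N) g)) (rectWalk x i j R T))) := by
  have hχ := continuous_fundChar N
  have h := hμ.2 (wilsonLoopObs (fun g => normalisedCharacter N (fundamentalRep (Fin N) g)) (rectWalk x i j R T))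
    _ (isCylinder_wilsonLoopObs _ _) (continuous_wilsonLoopObs hχ _) (exists_abs_wilsonLoopObs_le hχ _)
  simp only [toTorusObservable_wilsonLoopObs_rectWalk] at h
  exact h

/-- **Eventual torus bounds on a loop in general position pass to limit states.**  If `|⟨W_{proj x; i,j}(R×T)⟩_{β,𝓦 L,L+1}| ≤ b` for all large `L`,
then `|⟨W_{x;i,j}(R×T)⟩_μ| ≤ b` for every `μ ∈ perturbedLimitPoints β 𝓦`. [folklore] -/
theorem abs_loopExpectation_le_of_eventually_perturbed {β : ℝ} {𝓦 : PerturbationFamily d N} {μ : Measure (LGConfig d (SUN N))}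
    (hμ : μ ∈ perturbedLimitPoints β 𝓦) (x : Site d) (i j : Fin d) {R T : ℕ} {b : ℝ}
    (h : ∀ᶠ L : ℕ in atTop, |(𝓦 L).expectation (fundamentalRep (Fin N)) β
        (wilsonLoop (fundamentalRep (Fin N)) (Torus.proj (L + 1) x) i j R T)| ≤ b) :
    |loopExpectation μ (fun g => normalisedCharacter N (fundamentalRep (Fin N) g)) (rectWalk x i j R T)| ≤ b := by
  obtain ⟨Ls, hLs, hlim⟩ := hμ
  exact le_of_tendsto (tendsto_expectation_wilsonLoop_at hlim x i j R T).abs (hLs.tendsto_atTop.eventually h)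

/-- **Generic passage, all loops.**  If a torus bound `|⟨W_{y;i,j}(R×T)⟩_{β,W,L+1}| ≤ C^{2(R+T)}e^{−cRT}` holds for every `L`, every `W ∈ B L`, every base
point `y`, every `i ≠ j` and every loop with `2R, 2T ≤ L + 1`, then every limit state of every family eventually in `B` obeys the same bound for every
rectangular loop on `ℤ^d`. [folklore] -/
theorem loopBound_of_torusBound {β C c : ℝ} (B : (L : ℕ) → Set (Perturbation d (L + 1) N))
    (hA : ∀ (L : ℕ) (W : Perturbation d (L + 1) N), W ∈ B L →
      ∀ (y : Literature.MathematicalPhysics.QuantumFieldTheory.Site d (L + 1)) (i j : Fin d) (R T : ℕ), i ≠ j → 1 ≤ R → 1 ≤ T →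
        2 * R ≤ L + 1 → 2 * T ≤ L + 1 →
          |W.expectation (fundamentalRep (Fin N)) β (wilsonLoop (fundamentalRep (Fin N)) y i j R T)| ≤
            C ^ (2 * (R + T)) * Real.exp (-c * (R * T)))
    (𝓦 : PerturbationFamily d N) (h𝓦 : ∀ᶠ L : ℕ in atTop, 𝓦 L ∈ B L) {μ : Measure (LGConfig d (SUN N))}
    (hμ : μ ∈ perturbedLimitPoints β 𝓦) (x : Site d) {i j : Fin d} (hij : i ≠ j) {R T : ℕ} (hR : 1 ≤ R) (hT : 1 ≤ T) :
    |loopExpectation μ (fun g => normalisedCharacter N (fundamentalRep (Fin N) g)) (rectWalk x i j R T)| ≤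
      C ^ (2 * (R + T)) * Real.exp (-c * (R * T)) := by
  refine abs_loopExpectation_le_of_eventually_perturbed hμ x i j ?_
  filter_upwards [h𝓦, eventually_ge_atTop (2 * R + 2 * T)] with L hL hL'
  exact hA L (𝓦 L) hL (Torus.proj (L + 1) x) i j R T hij hR hT (by omega) (by omega)

/-- **AREA LAW OF THE LIMIT STATES FOR EVERY RECTANGULAR LOOP (tier-1 ball).**  Under `AreaLawOnBall N d β ε₀ ε₁ r mv`: ONE pair `(C, c)`, `c > 0`,
such that for every family eventually in `ClusterDomainFR ε₀ ε₁ r ∩ IsSlabLocal mv`, every `μ ∈ perturbedLimitPoints β 𝓦`, every base point `x : ℤ^d`,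
every plane `i ≠ j` and every `R, T ≥ 1`: `|⟨W_{x;i,j}(R×T)⟩_μ| ≤ C^{2(R+T)} e^{−cRT}`. [folklore] -/
theorem areaLaw_allLoops_onBall {β ε₀ ε₁ : ℝ} {r mv : ℕ} (h : AreaLawOnBall N d β ε₀ ε₁ r mv) :
    ∃ C c : ℝ, 0 < c ∧ ∀ 𝓦 : PerturbationFamily d N,
      (∀ᶠ L : ℕ in atTop, 𝓦 L ∈ ClusterDomainFR ε₀ ε₁ r ∧ IsSlabLocal mv (𝓦 L)) →
        ∀ μ ∈ perturbedLimitPoints β 𝓦, ∀ (x : Site d) (i j : Fin d) (R T : ℕ), i ≠ j → 1 ≤ R → 1 ≤ T →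
          |loopExpectation μ (fun g => normalisedCharacter N (fundamentalRep (Fin N) g)) (rectWalk x i j R T)| ≤
            C ^ (2 * (R + T)) * Real.exp (-c * (R * T)) := by
  obtain ⟨C, c, hc, hA⟩ := h
  refine ⟨C, c, hc, fun 𝓦 h𝓦 μ hμ x i j R T hij hR hT => loopBound_of_torusBound (β := β)
    (fun L => {W | W ∈ ClusterDomainFR ε₀ ε₁ r ∧ IsSlabLocal mv W}) (fun L W hW y i' j' R' T' hij' hR' hT' hRL hTL => ?_)
    𝓦 h𝓦 hμ x hij hR hT⟩
  exact hA (L + 1) W hW.1 hW.2 y i' j' R' T' hij' hR' hT' hRL hTL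

/-- **AREA LAW OF THE LIMIT STATES FOR EVERY RECTANGULAR LOOP (tier-2 ball).**  The same from `AreaLawOnBallW N d β κ ε₀ ε₁ mv` for families eventually
in `ClusterDomain κ ε₀ ε₁ ∩ IsSlabLocal mv`. [folklore] -/
theorem areaLaw_allLoops_onBallW {β κ ε₀ ε₁ : ℝ} {mv : ℕ} (h : AreaLawOnBallW N d β κ ε₀ ε₁ mv) :
    ∃ C c : ℝ, 0 < c ∧ ∀ 𝓦 : PerturbationFamily d N,
      (∀ᶠ L : ℕ in atTop, 𝓦 L ∈ ClusterDomain κ ε₀ ε₁ ∧ IsSlabLocal mv (𝓦 L)) →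
        ∀ μ ∈ perturbedLimitPoints β 𝓦, ∀ (x : Site d) (i j : Fin d) (R T : ℕ), i ≠ j → 1 ≤ R → 1 ≤ T →
          |loopExpectation μ (fun g => normalisedCharacter N (fundamentalRep (Fin N) g)) (rectWalk x i j R T)| ≤
            C ^ (2 * (R + T)) * Real.exp (-c * (R * T)) := by
  obtain ⟨C, c, hc, hA⟩ := h
  refine ⟨C, c, hc, fun 𝓦 h𝓦 μ hμ x i j R T hij hR hT => loopBound_of_torusBound (β := β)
    (fun L => {W | W ∈ ClusterDomain κ ε₀ ε₁ ∧ IsSlabLocal mv W}) (fun L W hW y i' j' R' T' hij' hR' hT' hRL hTL => ?_)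
    𝓦 h𝓦 hμ x hij hR hT⟩
  exact hA (L + 1) W hW.1 hW.2 y i' j' R' T' hij' hR' hT' hRL hTL

/-- **`SU(2)`, `d = 4`, `β_W = 1/3`, ball `(3/10, 3/20)`: every rectangular Wilson loop of every limit state** (any range `r`, window `mv ≥ 1`).
[folklore] -/
theorem su2_areaLaw_allLoops_oneThird (r : ℕ) {mv : ℕ} (hmv : 1 ≤ mv) :
    ∃ C c : ℝ, 0 < c ∧ ∀ 𝓦 : PerturbationFamily 4 2,
      (∀ᶠ L : ℕ in atTop, 𝓦 L ∈ ClusterDomainFR (3 / 10) (3 / 20) r ∧ IsSlabLocal mv (𝓦 L)) →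
        ∀ μ ∈ perturbedLimitPoints (1 / 6) 𝓦, ∀ (x : Site 4) (i j : Fin 4) (R T : ℕ), i ≠ j → 1 ≤ R → 1 ≤ T →
          |loopExpectation μ (fun g => normalisedCharacter 2 (fundamentalRep (Fin 2) g)) (rectWalk x i j R T)| ≤
            C ^ (2 * (R + T)) * Real.exp (-c * (R * T)) :=
  areaLaw_allLoops_onBall (su2_areaLawOnBall_oneThird_vertex r hmv)

/-- **The rectangle-perturbed `SU(2)` action at `β_W = 1/3` (`|τ| ≤ 1/2000`): area law for every rectangular loop of every limit state.** [folklore] -/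
theorem su2_rectangle_areaLaw_allLoops_oneThird (τ : ℝ) (hτ : |τ| ≤ 1 / 2000) :
    ∃ C c : ℝ, 0 < c ∧
      ∀ μ ∈ perturbedLimitPoints (1 / 6) (fun L : ℕ => termPerturbation (rectFamily 4 (L + 1) 2 τ)),
        ∀ (x : Site 4) (i j : Fin 4) (R T : ℕ), i ≠ j → 1 ≤ R → 1 ≤ T →
          |loopExpectation μ (fun g => normalisedCharacter 2 (fundamentalRep (Fin 2) g)) (rectWalk x i j R T)| ≤
            C ^ (2 * (R + T)) * Real.exp (-c * (R * T)) := by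
  obtain ⟨C, c, hc, hA⟩ := su2_areaLaw_allLoops_oneThird 2 (mv := 2) (by norm_num)
  exact ⟨C, c, hc, hA _ (rectangle_eventually_mem τ hτ)⟩

end Summit.Ventures.YMGap.RobustBall

end
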